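import Summits.AnomalousDissipation.AnomalousDissipation.Theorems.SolenoidalFractalHomogenisationLagrangianStepCellCorrectorContent
import Summits.AnomalousDissipation.AnomalousDissipation.Theorems.SolenoidalFractalHomogenisationLagrangianStepCellChainLinks
import HarnessLib

/-!
# K1L_D `LagrangianRenormalisationStepDesign` (stmt-AnomalousDissipation-27980), W7 engine sub-piece S1a: CLASS-PAIR CONFINEMENT of every weak
# solution of the flat tensor cell problem, in the support format of `ClassDecayW` (helper; `--supports stmt-AnomalousDissipation-27980`)

Summits-side helper file of route `SolenoidalFractalHomogenisation` (prover seat `ad-k1l-cellLawV-w1` g4).  Everything proved; no definitions, no named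
facts, no sorry.  `ClassDecayW W M hM lo hi Λ β ν₀ Kb CK cK adm` (DefsW7, p665306) quantifies over data `F` with `IsDatum F` whose modes vanish off the
CONJUGATE PAIR of Bloch classes `(ℓ + nℤ³) ∪ (−ℓ + nℤ³)` — `∀ k', (¬ ∃ z, k' = ℓ + n•z) → (¬ ∃ z, k' = −ℓ + n•z) → ∀ i, modeCoeff k' F i = 0` — and over
weak solutions `u` of the cell problem `IsWeakTensorPassiveVectorOn 0 T ((1/n²)•𝔸) (cellField W M hM ν _ n) F u`.  Here:

* `class_iff_dvd`, `negClass_iff_dvd` — the dictionary between the coset description `k' = ±ℓ + n•z` and the divisibility description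
  `∀ i, n ∣ k' i ∓ ℓ i` used by the Literature brick;
* **`ae_modes_vanish_off_classPair`** — every such `u` keeps its modes on the class pair for a.e. `t ∈ (0,T)`:
  `∀ᵐ t, ∀ k', (¬ ∃ z, k' = ℓ + n•z) → (¬ ∃ z, k' = −ℓ + n•z) → 𝓕(complexify ∘ u t)(k') = 0`, and the `modeCoeff` form
  `ae_modeCoeff_vanish_off_classPair` — Bloch-sector preservation of EVERY weak solution along the `1/n`-periodic cell carrier
  (`PassiveVectorTensorSymmetry.ae_mFourierCoeff_eq_zero_off_sector`, uniqueness in the class), now for a GENERAL `L²` datum on the pair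
  (the single-mode case is `cell_sector_preservation`, p635910).
So the W7 chain analysis runs on ONE Bloch fibre `K₀ + ℤ³` (in cell units) and its mirror, as planner ad-ideate-p4 g13's memo §1 assumes.
NOT a proof of any registered stub, of the crux, or of anomalous dissipation; rung F-D1.A0 infrastructure.
-/

set_option linter.dupNamespace false

noncomputable section

namespace Summit.AnomalousDissipation.AnomalousDissipation.Theorems.SolenoidalFractalHomogenisation.LagrangianStep.CellChain

open Set MeasureTheory Filter Topology Function Complex UnitAddTorus
open scoped InnerProductSpace ENNReal
open Literature.Analysis Literature.Analysis.FunctionSpaces Literature.Analysis.FunctionSpaces.Torus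
open Literature.Analysis.FluidPDE Literature.Analysis.FluidPDE.LatticeShear
open Summit.AnomalousDissipation.AnomalousDissipation.Theorems.SolenoidalFractalHomogenisation.RealisedQuasiStaticCellLaw
open Summit.AnomalousDissipation.AnomalousDissipation.Theorems.SolenoidalFractalHomogenisation.LagrangianStep

/-- Coset ↔ divisibility: `(∃ z, k' = ℓ + n•z) ↔ ∀ i, n ∣ k' i − ℓ i`. [folklore] -/
theorem class_iff_dvd (n : ℕ) (ℓ k' : Fin 3 → ℤ) :
    (∃ z : Fin 3 → ℤ, k' = ℓ + (n : ℤ) • z) ↔ ∀ i, (n : ℤ) ∣ k' i - ℓ i := by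
  constructor
  · rintro ⟨z, rfl⟩ i
    refine ⟨z i, ?_⟩
    simp
  · intro hdvd
    choose z hz using hdvd
    refine ⟨z, funext fun i => ?_⟩
    have := hz i
    simp only [Pi.add_apply, Pi.smul_apply, smul_eq_mul]
    linarith

/-- Coset ↔ divisibility for the conjugate class: `(∃ z, k' = −ℓ + n•z) ↔ ∀ i, n ∣ k' i + ℓ i`. [folklore] -/
theorem negClass_iff_dvd (n : ℕ) (ℓ k' : Fin 3 → ℤ) :
    (∃ z : Fin 3 → ℤ, k' = -ℓ + (n : ℤ) • z) ↔ ∀ i, (n : ℤ) ∣ k' i + ℓ i := by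
  rw [class_iff_dvd]
  refine forall_congr' fun i => ?_
  rw [Pi.neg_apply, sub_neg_eq_add]

/-- **Class-pair confinement of every weak solution of the flat tensor cell problem.**  If the `L²` datum `F` has no modes off the conjugate
pair of Bloch classes `(ℓ + nℤ³) ∪ (−ℓ + nℤ³)`, then so does every weak solution along the cell carrier, for a.e. `t ∈ (0,T)`.
[cite: KhaKuchment2021, §1.1–§1.2 (G-periodic operators, γ_k-automorphic functions)] -/
theorem ae_modes_vanish_off_classPair {k : ℕ} (W : LatticeWord k) (M : ℝ) (hM : 0 < M) {lo hi lam ν : ℝ} (hlo : 0 < lo)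
    (hlam : 0 < lam) (hν : 0 < ν) {n : ℕ} (hn : 0 < n) {𝔸 : Torus.Visc4 (Fin 3)}
    (hA : Torus.NearIso 𝔸 (ν * (lo / lam)) (ν * (hi * lam))) (ℓ : Fin 3 → ℤ) {F : VF} (hF : MemLp F 2 volume)
    (hsupp : ∀ k' : Fin 3 → ℤ, (¬ ∃ z : Fin 3 → ℤ, k' = ℓ + (n : ℤ) • z) → (¬ ∃ z : Fin 3 → ℤ, k' = -ℓ + (n : ℤ) • z) →
      mFourierCoeff (FunctionSpaces.EuclideanSpace.complexify ∘ F) k' = 0)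
    {T : ℝ} {u : ℝ → VF}
    (hu : Torus.IsWeakTensorPassiveVectorOn 0 T ((1 / (n:ℝ) ^ 2) • 𝔸) (cellField W M hM ν hν n) F u) :
    ∀ᵐ t ∂(volume.restrict (Ioo 0 T)), ∀ k' : Fin 3 → ℤ,
      (¬ ∃ z : Fin 3 → ℤ, k' = ℓ + (n : ℤ) • z) → (¬ ∃ z : Fin 3 → ℤ, k' = -ℓ + (n : ℤ) • z) →
      mFourierCoeff (FunctionSpaces.EuclideanSpace.complexify ∘ u t) k' = 0 := by
  have hN : Torus.NearIso ((1 / (n:ℝ) ^ 2) • 𝔸) ((1 / (n:ℝ) ^ 2) * (ν * (lo / lam))) ((1 / (n:ℝ) ^ 2) * (ν * (hi * lam))) :=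
    hA.smul (by positivity)
  have hlo' : 0 < (1 / (n:ℝ) ^ 2) * (ν * (lo / lam)) := by positivity
  have hb : MemLp (FunctionSpaces.Torus.stLift (cellField W M hM ν hν n)) ∞
      (volume.restrict (Ioo 0 T ×ˢ (univ : Set (EuclideanSpace ℝ (Fin 3))))) := by
    rw [cellField_eq_cell]
    exact memLp_top_stLift_cell _ n T
  have hper : ∀ (j : Fin 3 → Fin n) t x, cellField W M hM ν hν n t (x + fun i => ((((j i : ℕ) : ℝ) / n : ℝ) : UnitAddCircle)) =
      cellField W M hM ν hν n t x := fun j t x => by rw [cellField_eq_cell]; exact cell_add_grid _ hn j t x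
  have hsuppSec : ∀ k', mFourierCoeff (FunctionSpaces.EuclideanSpace.complexify ∘ F) k' ≠ 0 →
      (∀ i, (n : ℤ) ∣ k' i - ℓ i) ∨ (∀ i, (n : ℤ) ∣ k' i + ℓ i) := by
    intro k' hk'
    by_contra hcon
    rw [not_or] at hcon
    exact hk' (hsupp k' (mt (class_iff_dvd n ℓ k').1 hcon.1) (mt (negClass_iff_dvd n ℓ k').1 hcon.2))
  filter_upwards [hu.ae_mFourierCoeff_eq_zero_off_sector hn ℓ hN hlo' hb hper hF hsuppSec] with t ht k' h1 h2
  exact ht k' (fun hor => hor.elim (fun h => h1 ((class_iff_dvd n ℓ k').2 h)) (fun h => h2 ((negClass_iff_dvd n ℓ k').2 h)))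

/-- The same in the `modeCoeff` format of `ClassDecayW` / `HighLabelDecayW` (datum with `IsDatum`, support hypothesis on `modeCoeff`):
for a.e. `t`, `modeCoeff k' (u t) i = 0` for every `k'` off the class pair and every `i`. [cite: KhaKuchment2021, §1.1–§1.2 (G-periodic operators, γ_k-automorphic functions)] -/
theorem ae_modeCoeff_vanish_off_classPair {k : ℕ} (W : LatticeWord k) (M : ℝ) (hM : 0 < M) {lo hi lam ν : ℝ} (hlo : 0 < lo)
    (hlam : 0 < lam) (hν : 0 < ν) {n : ℕ} (hn : 0 < n) {𝔸 : Torus.Visc4 (Fin 3)}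
    (hA : Torus.NearIso 𝔸 (ν * (lo / lam)) (ν * (hi * lam))) (ℓ : Fin 3 → ℤ) {F : VF} (hF : IsDatum F)
    (hsupp : ∀ k' : Fin 3 → ℤ, (¬ ∃ z : Fin 3 → ℤ, k' = ℓ + (n : ℤ) • z) → (¬ ∃ z : Fin 3 → ℤ, k' = -ℓ + (n : ℤ) • z) →
      ∀ i, modeCoeff k' F i = 0)
    {T : ℝ} {u : ℝ → VF}
    (hu : Torus.IsWeakTensorPassiveVectorOn 0 T ((1 / (n:ℝ) ^ 2) • 𝔸) (cellField W M hM ν hν n) F u) :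
    ∀ᵐ t ∂(volume.restrict (Ioo 0 T)), ∀ k' : Fin 3 → ℤ,
      (¬ ∃ z : Fin 3 → ℤ, k' = ℓ + (n : ℤ) • z) → (¬ ∃ z : Fin 3 → ℤ, k' = -ℓ + (n : ℤ) • z) →
      mFourierCoeff (FunctionSpaces.EuclideanSpace.complexify ∘ u t) k' = 0 ∧ ∀ i, modeCoeff k' (u t) i = 0 := by
  have hF2 : MemLp F 2 volume := memLp_two_of_memSobolev_one_complexify hF.1
  have hFi : Integrable F volume := hF2.integrable one_le_two
  have hsupp' : ∀ k' : Fin 3 → ℤ, (¬ ∃ z : Fin 3 → ℤ, k' = ℓ + (n : ℤ) • z) → (¬ ∃ z : Fin 3 → ℤ, k' = -ℓ + (n : ℤ) • z) →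
      mFourierCoeff (FunctionSpaces.EuclideanSpace.complexify ∘ F) k' = 0 := by
    intro k' h1 h2
    ext i
    rw [← modeCoeff_eq hFi, hsupp k' h1 h2 i]
    rfl
  filter_upwards [ae_modes_vanish_off_classPair W M hM hlo hlam hν hn hA ℓ hF2 hsupp' hu, hu.ae_integrable_slice] with t ht hint k' h1 h2
  refine ⟨ht k' h1 h2, fun i => ?_⟩
  rw [modeCoeff_eq hint.1, ht k' h1 h2]
  rfl

end Summit.AnomalousDissipation.AnomalousDissipation.Theorems.SolenoidalFractalHomogenisation.LagrangianStep.CellChain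

end
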